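/-
Origin: expansion seat `planner-pub-hodgecm-pohl-g7-0`, handover #2v2 2026-08-18T06:59:52Z (`HOME/pub-hodgecm-pohl-g7/lean/Pohl7/KillH0UnitH0.lean`, md5 cbe69b00, 84 lines);
landed by the gen-7 packager in gate run 25 as `HodgeCM/Model/KillH0UnitH0.lean` (import ^import Pohl7\.ToyKillH0\b→import HodgeCM.Model.Toy.KillH0 ×1).
-/
/-
# `U♭` has no unit classes: F-H0 is independent of the rest of the [QW8]-side generic list

Origin: pub-hodgecm-pohl-g7 (EXPANSION (b) `PohlmannSpan`, generation 7), HANDOVER #2 (RUN 25).  Intended target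
`HodgeCM/Model/KillH0UnitH0.lean`, module `HodgeCM.Model.KillH0UnitH0`.  ADDITIVE leaf; land AFTER qw8-g4's
`HodgeCM.StubTree.Qw8GysinDescentH0` (run 25, HANDOVER #3a) and after this seat's `HodgeCM.Model.Toy.KillH0` (HANDOVER #1, file 3).

qw8-g4's run-25 file `StubTree/Qw8GysinDescentH0` presents the Gysin-type input F7d `Fact_gysinDescent` as
F-H0 `Fact_unitH0` (UNIT CLASSES: `1_X ∈ H⁰(X, ℚ)` natural, `1_X ∪ z = z`, `H⁰(A_Θ) = ℚ · 1_{A_Θ}`; Hatcher §3.2 p.266 L5,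
Prop. 3.10 p.270 L3, §3.1 p.256 L5) plus the algebraicity clause F7d-B `Fact_gysinDescentB`, the residual generic inputs of
COR-CM being `ModelAxioms`, N1–N4, F4, F5, `Fact_dimProd`, F-H0, F7d-B (`Assembly.COR_CM_of_descentFactsB`).

This file records, by name, that F-H0 is NOT a consequence of the other members of that list (nor of F7d itself):
* `Universe.KillH0.not_fact_unitH0 (h22 : U.Fact_H1_rank) : ¬ U.killH0.Fact_unitH0` — the unit law (clause (ii)) already
  fails in every `U♭` (`KillH0.not_unitLaw`, `Model/KillH0Descent`);
* `Universe.KillH0.fact_gysinDescentB` — F7d-B transfers to `U♭` (through F7d);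
* `Toy.unitH0_independent : ∃ U, (U.ModelAxioms ∧ N1 ∧ N2 ∧ N3 ∧ N4 ∧ F4 ∧ F5 ∧ Fact_dimProd ∧ F7d-B ∧ F7d) ∧ ¬ U.Fact_unitH0`
  (witness `toyModel.killH0`), and the pointwise form `Toy.fact_unitH0_not_derivable`.
So in the presentation (`ModelAxioms`, N1–N4, F4, F5, `Fact_dimProd`, F-H0, F7d-B) the member F-H0 is a genuinely separate
cited input — the degree-`0` input of the all-`p` Pohlmann theorem in its unit-class form (cf. `Toy.degreeZero_independent`).
KERNEL over tree files; nothing cited; no hypothesis named after PerL / [QW8] / the 2001 programme.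
-/
import Summits.HodgeConjecture.HodgeCM.StubTree.Qw8GysinDescentH0
import Summits.HodgeConjecture.HodgeCM.Model.Toy.KillH0

/-! PORT of `HodgeCM/Model/KillH0UnitH0.lean` (HodgeCMPerL run 82) — verbatim mechanical port; provenance in the PORT header line. -/

noncomputable section

open scoped TensorProduct NumberField Classical

namespace HodgeCM

namespace Universe

namespace KillH0

variable {U : Universe}

/-- **F-H0 fails in `U♭`.**  No unit-class family exists in `U.killH0` once `U` has M22: clause (ii) `1_X ∪ z = z` of
`Fact_unitH0` is the unit law refuted by `KillH0.not_unitLaw`. -/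
theorem not_fact_unitH0 (h22 : U.Fact_H1_rank) : ¬ U.killH0.Fact_unitH0 :=
  fun ⟨one, _, h, _⟩ => not_unitLaw h22 ⟨one, h⟩

/-- F7d-B (the algebraicity clause of Gysin descent) transfers to `U♭` — through F7d. -/
theorem fact_gysinDescentB (h2 : U.Fact_pull_comp) (h0 : U.H0Rigid) (h : U.Fact_gysinDescent) :
    U.killH0.Fact_gysinDescentB :=
  gysinDescentB_of_gysinDescent (fact_gysinDescent h2 h0 h)

end KillH0

end Universe

namespace Toy

open Universe

/-- (Ported verbatim from the HodgeCMPerL package; no docstring in the source.) -/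
theorem killH0_not_fact_unitH0 : ¬ toyModel.killH0.Fact_unitH0 :=
  KillH0.not_fact_unitH0 toyModel_modelAxioms.H1_rank

/-- (Ported verbatim from the HodgeCMPerL package; no docstring in the source.) -/
theorem killH0_fact_gysinDescentB : toyModel.killH0.Fact_gysinDescentB :=
  KillH0.fact_gysinDescentB toyModel_modelAxioms.pull_comp toyModel_h0Rigid toyModel_fact_gysinDescent

/-- **F-H0 is independent of the rest of the [QW8]-side generic list.**  The `H⁰`-free exterior universe `toyModel♭`
satisfies `ModelAxioms`, N1–N4, F4, F5, `Fact_dimProd`, F7d-B (and F7d), and has NO unit classes. -/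
theorem unitH0_independent :
    ∃ U : Universe, (U.ModelAxioms ∧ U.Fact_cupExterior ∧ U.Fact_cup_hodge ∧ U.Fact_pull_H0 ∧ U.Fact_hodge_F0 ∧
      U.Fact_cupAlg ∧ U.Fact_cupAssoc ∧ U.Fact_dimProd ∧ U.Fact_gysinDescentB ∧ U.Fact_gysinDescent) ∧
      ¬ U.Fact_unitH0 :=
  ⟨toyModel.killH0, ⟨killH0_modelAxioms, killH0_fact_cupExterior, killH0_fact_cup_hodge, killH0_fact_pull_H0,
    killH0_fact_hodge_F0, killH0_fact_cupAlg, killH0_fact_cupAssoc, killH0_fact_dimProd, killH0_fact_gysinDescentB,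
    killH0_fact_gysinDescent⟩, killH0_not_fact_unitH0⟩

/-- Pointwise form: F-H0 is not derivable from `ModelAxioms` + N1–N4 + F4 + F5 + `Fact_dimProd` + F7d-B. -/
theorem fact_unitH0_not_derivable :
    ¬ ∀ U : Universe, U.ModelAxioms → U.Fact_cupExterior → U.Fact_cup_hodge → U.Fact_pull_H0 → U.Fact_hodge_F0 →
      U.Fact_cupAlg → U.Fact_cupAssoc → U.Fact_dimProd → U.Fact_gysinDescentB → U.Fact_unitH0 :=
  fun h => killH0_not_fact_unitH0 (h _ killH0_modelAxioms killH0_fact_cupExterior killH0_fact_cup_hodge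
    killH0_fact_pull_H0 killH0_fact_hodge_F0 killH0_fact_cupAlg killH0_fact_cupAssoc killH0_fact_dimProd
    killH0_fact_gysinDescentB)

end Toy

end HodgeCM

end
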